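import Summits.SmoothPoincare4.SmoothPoincare4.Theorems.RootDecompAEDoublesBeyondShadowTwoLedgerGluing

/-!
# Grade-four ownership ledger `LocalTableLE4 → GradeFourDichotomy` for KMN encoding graphs, part 10/15: Laplace = Leibniz; the local step

§10 `det_eq_matrix_det`: the block calculus' list determinant of a square matrix is `Matrix.det` (Laplace expansion
along the first row = `Matrix.det_succ_row_zero`); THE LOCAL MINOR IS A UNIT `minor_unit_of_um` for every rank `≤ 5`
(row signs factor out by `Matrix.det_mul_column`); THE LOCAL STEP `localCert_of_um`: local unimodularity of (rows at
`u`) × (used letters of `u`) gives, through the local table, a local certificate on exactly the used ports.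

THE FAMILY (14 modules `Theorems/RootDecompAEDoublesBeyondShadowTwoLedger*.lean` + the closing module
`Theorems/RootDecompAEDoublesBeyondShadowTwoStubLedgerFour.lean`, one namespace
`Summit.SmoothPoincare4.SmoothPoincare4.Theorems.RootDecompAEDoublesBeyondShadowTwoStubLedgerFour`, linearly chained
imports, split by topic to respect the 400-line bound on proof files).
-/

open Function
open Literature.Topology.FourManifolds

set_option linter.dupNamespace false

noncomputable section

namespace Summit.SmoothPoincare4.SmoothPoincare4.Theorems.RootDecompAEDoublesBeyondShadowTwoStubLedgerFour

/-! ## §10 The local step: local unimodularity at a piece gives the hypotheses of the local table -/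

section Laplace

open Block

/-- Left fold of additions is a sum. -/
private theorem foldl_add_eq {α : Type} (f : α → ℤ) : ∀ (l : List α) (a : ℤ),
    l.foldl (fun acc j => acc + f j) a = a + (l.map f).sum
  | [], a => by simp
  | x :: l, a => by rw [List.foldl_cons, foldl_add_eq f l, List.map_cons, List.sum_cons, add_assoc]

/-- The sum over `range n` as a list is the sum over `Fin n`. -/
private theorem sum_map_range_eq (f : ℕ → ℤ) (n : ℕ) : ((List.range n).map f).sum = ∑ j : Fin n, f j := by
  induction n with
  | zero => simp
  | succ n ih => rw [List.range_succ, List.map_append, List.sum_append, ih, Fin.sum_univ_castSucc]; simp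

/-- The Laplace sign. -/
private theorem laplace_sign (j : ℕ) : (if j % 2 = 0 then (1 : ℤ) else -1) = (-1) ^ j := by
  rcases Nat.even_or_odd j with h | h
  · rw [if_pos (Nat.even_iff.mp h), h.neg_one_pow]
  · rw [if_neg (by rw [Nat.odd_iff.mp h]; decide), h.neg_one_pow]

/-- Entries of an erased row: `(row.eraseIdx j)[k] = row[succAbove j k]`. -/
private theorem getD_eraseIdx_succAbove {r : ℕ} (row : List ℤ) (j : Fin (r + 1)) (k : Fin r) :
    (row.eraseIdx j).getD k 0 = row.getD (j.succAbove k) 0 := by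
  rw [List.getD_eq_getElem?_getD, List.getD_eq_getElem?_getD, List.getElem?_eraseIdx]
  unfold Fin.succAbove
  by_cases h : (k : ℕ) < (j : ℕ)
  · rw [if_pos h, if_pos (by exact h)]; rfl
  · rw [if_neg h, if_neg (by exact h)]; rfl

/-- **LAPLACE = LEIBNIZ.**  The block calculus' list determinant of a square integer matrix is `Matrix.det`. -/
theorem det_eq_matrix_det : ∀ (r : ℕ) (M : List (List ℤ)), M.length = r → (∀ row ∈ M, row.length = r) →
    Block.det M = (Matrix.of fun i j : Fin r => (M.getD i []).getD j 0).det
  | 0, M, hM, _ => by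
    rw [List.eq_nil_of_length_eq_zero hM, Matrix.det_isEmpty]
    rfl
  | r + 1, [], hM, _ => absurd hM (by simp)
  | r + 1, row :: rest, hM, hrows => by
    have hrow : row.length = r + 1 := hrows row (by simp)
    have hrest : rest.length = r := by simpa using hM
    rw [Block.det, hM, detAux, foldl_add_eq, zero_add, hrow, sum_map_range_eq, Matrix.det_succ_row_zero]
    refine Finset.sum_congr rfl fun j _ => ?_
    have hsub : Block.det (rest.map fun r' => r'.eraseIdx j) =
        ((Matrix.of fun i j : Fin (r + 1) => ((row :: rest).getD i []).getD j 0).submatrix Fin.succ j.succAbove).det := by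
      rw [det_eq_matrix_det r (rest.map fun r' => r'.eraseIdx j) (by simp [hrest]) (by
        intro row' hrow'
        rw [List.mem_map] at hrow'
        obtain ⟨r', hr', rfl⟩ := hrow'
        have := hrows r' (by simp [hr'])
        rw [List.length_eraseIdx_of_lt (by rw [this]; exact j.isLt), this]; rfl)]
      congr 1
      ext i k
      simp only [Matrix.of_apply, Matrix.submatrix_apply]
      have hi : (i : ℕ) < rest.length := hrest ▸ i.isLt
      have h1 : (rest.map fun r' => r'.eraseIdx j).getD i [] = (rest[(i : ℕ)]).eraseIdx j := by
        rw [List.getD_eq_getElem _ _ (by simpa using hi), List.getElem_map]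
      have h2 : (row :: rest).getD (Fin.succ i) [] = rest[(i : ℕ)] := by
        rw [Fin.val_succ, List.getD_cons_succ, List.getD_eq_getElem _ _ hi]
      rw [h1, getD_eraseIdx_succAbove, h2]
    have hdet : detAux r (rest.map fun r' => r'.eraseIdx j) = Block.det (rest.map fun r' => r'.eraseIdx j) := by
      rw [Block.det, List.length_map, hrest]
    rw [hdet, hsub, laplace_sign]
    simp only [Matrix.of_apply]
    rfl

end Laplace

namespace ShadowGraph

variable (G₄ : ShadowGraph)

/-- The ports of `u` used by the rows `ru`, in increasing order. -/
def uports (ru : Finset (Fin G₄.m)) (u : Fin G₄.k) : List ℕ := (ru.image fun e => G₄.uport e u).sort (· ≤ ·)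

variable {G₄}

/-- Membership in the port list of `ru` at `u`. -/
theorem mem_uports₄ {ru : Finset (Fin G₄.m)} {u : Fin G₄.k} {j : ℕ} :
    j ∈ G₄.uports ru u ↔ ∃ e ∈ ru, G₄.uport e u = j := by
  simp [uports, Finset.mem_image]

/-- The entries of the table at `u` in a row at `u`: signed exponents of the used port word. -/
theorem tab_u_pexp (hself : ∀ e, (G₄.src e).1 ≠ (G₄.tgt e).1) {e : Fin G₄.m} {u : Fin G₄.k}
    (ht : (G₄.src e).1 = u ∨ (G₄.tgt e).1 = u) (i : Fin 5) :
    G₄.tab e (Sum.inl (u, i)) = G₄.ucoef e u * pexp (G₄.piece u) (G₄.uport e u) i :=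
  tab_u (hself e) ht i

/-- Entries of the local exponent matrix. -/
theorem pmat_entry (p : Piece) (J : List ℕ) (a b : Fin J.length) :
    ((pmat p J).getD a []).getD b 0 = pexpN p J[(a : ℕ)] b := by
  unfold pmat
  have ha : (J.map fun j => (List.range J.length).map (pexpN p j)).getD a [] =
      (List.range J.length).map (pexpN p J[(a : ℕ)]) := by
    rw [List.getD_eq_getElem?_getD, List.getElem?_map, List.getElem?_eq_getElem a.isLt]; rfl
  rw [ha, List.getD_eq_getElem?_getD, List.getElem?_map, List.getElem?_range b.isLt]; rfl

/-- THE LOCAL MINOR IS A UNIT: if the block `ru × cols {u}` is unimodular and `J` lists ports of rows of `ru` at `u`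
without repetition, `rank u` of them, the local minor of `J` is `±1` (the row signs `ucoef = ±1` factor out of the
determinant, and the list determinant is `Matrix.det`). -/
theorem minor_unit_of_um₄ (hself : ∀ e, (G₄.src e).1 ≠ (G₄.tgt e).1) {u : Fin G₄.k} {ru : Finset (Fin G₄.m)}
    (hru : ∀ e ∈ ru, (G₄.src e).1 = u ∨ (G₄.tgt e).1 = u) (hum : UM G₄.tab ru (G₄.cols {u})) {J : List ℕ}
    (hlen : J.length = (G₄.piece u).rank) (hpw : J.Pairwise (· < ·)) (hJ : ∀ j ∈ J, ∃ e ∈ ru, G₄.uport e u = j) :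
    minor (G₄.piece u) J = 1 ∨ minor (G₄.piece u) J = -1 := by
  classical
  set p := G₄.piece u with hp
  have hcard : ru.card = J.length := by rw [hum.card_eq, cols_singleton_card₄, hlen]
  have hr5 : J.length ≤ 5 := hlen ▸ rank_le_five p
  have hnd : J.Nodup := hpw.imp fun h => h.ne
  -- rows: the gluing using port `J[a]`; columns: the letters `x_(u, b)`
  have hex : ∀ a : Fin J.length, ∃ e ∈ ru, G₄.uport e u = J[(a : ℕ)] := fun a => hJ _ (List.getElem_mem a.isLt)
  choose f hfru hfport using hex
  set g : Fin J.length → G₄.Gen := fun b => Sum.inl (u, ⟨b, lt_of_lt_of_le b.isLt hr5⟩) with hg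
  have hf : Function.Injective f := by
    intro a a' h
    have := hfport a
    rw [h, hfport a'] at this
    exact Fin.ext ((hnd.getElem_inj_iff).mp this.symm)
  have hginj : Function.Injective g := by
    intro b b' h
    simp only [hg, Sum.inl.injEq, Prod.mk.injEq, true_and, Fin.mk.injEq] at h
    exact Fin.ext h
  have hgc : ∀ b, g b ∈ G₄.cols {u} := fun b =>
    (G₄.inl_mem_cols _ _ _).mpr ⟨Finset.mem_singleton_self u, by rw [← hp, ← hlen]; exact b.isLt⟩
  have key := hum.isUnit_det_enum f g hf hginj hfru hgc hcard
  -- factor out the row signs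
  have hmat : (Matrix.of fun a b => G₄.tab (f a) (g b)) =
      Matrix.of fun a b : Fin J.length => G₄.ucoef (f a) u * ((pmat p J).getD a []).getD b 0 := by
    ext a b
    simp only [Matrix.of_apply, hg, tab_u_pexp hself (hru _ (hfru a)), hfport a, pmat_entry, pexpN,
      dif_pos (lt_of_lt_of_le b.isLt hr5), hp]
  rw [hmat, Matrix.det_mul_column, IsUnit.mul_iff] at key
  have hdet : IsUnit (Matrix.of fun a b : Fin J.length => ((pmat p J).getD a []).getD b 0).det := key.2
  rw [← det_eq_matrix_det J.length (pmat p J) (by simp [pmat]) (fun row hrow => by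
      unfold pmat at hrow
      rw [List.mem_map] at hrow
      obtain ⟨j, -, rfl⟩ := hrow
      simp)] at hdet
  exact Int.isUnit_iff.mp hdet

/-- **THE LOCAL STEP.**  Local unimodularity at a piece `u` on rows `ru` at `u` yields a local elimination
certificate of `piece u` on exactly the ports used by `ru` (hypotheses of the local table + the local table, which
for blocks is the hypothesis `LocalTableLE4` read through `roe_sound`). -/
theorem localCert_of_um (hLT : LocalTableLE4) (hV : G₄.PortsValid) (hI : G₄.PortsInjective)
    (hself : ∀ e, (G₄.src e).1 ≠ (G₄.tgt e).1)
    {u : Fin G₄.k} {ru : Finset (Fin G₄.m)} (hru : ∀ e ∈ ru, (G₄.src e).1 = u ∨ (G₄.tgt e).1 = u)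
    (hum : UM G₄.tab ru (G₄.cols {u})) : LocalCert (G₄.piece u) (G₄.uports ru u) := by
  classical
  have hcard : ru.card = (G₄.piece u).rank := by rw [hum.card_eq, cols_singleton_card₄]
  have hinj : Set.InjOn (fun e => G₄.uport e u) ru := by
    intro e₁ h₁ e₂ h₂ h
    by_contra hne
    exact uport_ne₄ hI hne (hru e₁ h₁) (hru e₂ h₂) h
  have hlen : (G₄.uports ru u).length = (G₄.piece u).rank := by
    rw [uports, Finset.length_sort, Finset.card_image_of_injOn hinj, hcard]
  have hpw : (G₄.uports ru u).Pairwise (· < ·) := (Finset.sortedLT_sort _).pairwise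
  have hlt : ∀ j ∈ G₄.uports ru u, j < (G₄.piece u).numPorts := by
    intro j hj
    obtain ⟨e, he, rfl⟩ := mem_uports₄.mp hj
    exact uport_lt₄ hV (hru e he)
  exact localTable hLT (G₄.piece u)
    ⟨hlen, hpw, hlt, minor_unit_of_um₄ hself hru hum hlen hpw fun j hj => mem_uports₄.mp hj⟩

end ShadowGraph

end Summit.SmoothPoincare4.SmoothPoincare4.Theorems.RootDecompAEDoublesBeyondShadowTwoStubLedgerFour
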